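import Mathlib
import HarnessLib
import Literature.Analysis.FluidPDE.TaoCascadeODE

/-!
# Katz–Pavlović weight conjugacy: Tao's cascade nonlinearity is shell-homogeneous in the weighted amplitudes
# (helper file for the crux `SubOnsagerCeiling.ForwardTailCeilingKP`, stmt-NavierStokesRegularity-27057, `--supports`)

For a table `α` at scale ratio `b = 1+ε₀` write `λ = b^{5/2}` and `W_{j,k} := λ^k X_{j,k}` (Katz–Pavlović weights).  Then
`λ^n · quadTerm ε₀ α X i n = Σ_{i₁,i₂} Σ_{μ∈S} α_{i₁i₂i}^{μ} · λ^{μ₃−μ₁−μ₂} · W_{i₁,n−μ₃+μ₁} W_{i₂,n−μ₃+μ₂}` — the shell index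
`n` has DISAPPEARED from the coefficients (`kpWeight_quadTerm`; on Tao's shift set the four weights are `1` for `(0,0,0)`,
`λ⁻¹` for `(1,0,0)` and `(0,1,0)`, `λ` for `(0,0,1)`: `kpWeight_shift_values`), and the viscous model equation
`X' = quadTerm − ν b^{2k} X` becomes the autonomous, degree-two, shell-homogeneous lattice
`W' = [the same form] − ν b^{2k} W` (`kpWeight_hasDerivWithinAt`).  For the one-mode chain this is
`W_k' = λ W_{k−1}² − λ⁻¹ W_k W_{k+1} − ν b^{2k} W_k`.

This is the algebraic first step of the Dombre–Gilson renormalisation of the blow-up front (time change `dτ = S dt`,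
`v = W/S`, `d log S/dτ` fixed by a conserved norm; travelling waves `v_k(τ) = V(k − sτ)` = self-similar fronts with exponent
`y`, [cite: DombreGilson1998, §3] [cite: Mailybaev2013Bifurcations, §3, Thm. 2]) on which the front-exponent dictionary
`Theorems/SubOnsagerCeilingKPChainFrontExponent.lean` and the repair census R1b (front renormalisation for the primaries of
KP networks proper, hands leafhand-4-g0/g1/g2) rest; it holds for EVERY table, not only the chain, so the same
renormalisation applies to all primary networks of the registered stubs. [cite: Tao2016AveragedNS, §3 (dyadic scale
invariance, remark after Def. 3.1), §4 (4.8)]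

HONEST FRAMING: an algebraic identity about Tao-type MODEL lattice ODEs (route SubOnsagerCeiling, rung TL-M2Break); no stub,
crux or summit is proved here and nothing in this file bears on Navier–Stokes regularity.
-/

noncomputable section

-- the sub-problem namespace `NavierStokesRegularity.NavierStokesRegularity` is the tree's layout (D-0017)
set_option linter.dupNamespace false

namespace Summit.NavierStokesRegularity.NavierStokesRegularity.Theorems

open Finset
open Literature.Analysis.FluidPDE.TaoCascade

/-- **KP weight conjugacy of `quadTerm`.** With `λ = (1+ε₀)^{5/2}` and `W_{j,k} = λ^k X_{j,k}`:
`λ^n · quadTerm ε₀ α X i n t = Σ_{i₁,i₂} Σ_{μ∈S} α i₁ i₂ i μ · λ^{μ₃−μ₁−μ₂} · W_{i₁,n−μ₃+μ₁}(t) · W_{i₂,n−μ₃+μ₂}(t)` — the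
coefficients no longer depend on the shell `n`. [cite: Tao2016AveragedNS, §3 (remark after Def. 3.1), §4 (4.8)] -/
theorem kpWeight_quadTerm {ε₀ : ℝ} (hε : 0 < ε₀) {m : ℕ} (α : Fin m → Fin m → Fin m → ℤ × ℤ × ℤ → ℝ)
    (X : Fin m → ℤ → ℝ → ℝ) (i : Fin m) (n : ℤ) (t : ℝ) :
    (1 + ε₀) ^ ((5 : ℝ) / 2 * (n : ℝ)) * quadTerm ε₀ α X i n t =
      ∑ i₁ : Fin m, ∑ i₂ : Fin m, ∑ μ ∈ shiftSet,
        α i₁ i₂ i μ * (1 + ε₀) ^ ((5 : ℝ) / 2 * ((μ.2.2 : ℝ) - (μ.1 : ℝ) - (μ.2.1 : ℝ))) *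
          (((1 + ε₀) ^ ((5 : ℝ) / 2 * ((n - μ.2.2 + μ.1 : ℤ) : ℝ)) * X i₁ (n - μ.2.2 + μ.1) t) *
            ((1 + ε₀) ^ ((5 : ℝ) / 2 * ((n - μ.2.2 + μ.2.1 : ℤ) : ℝ)) * X i₂ (n - μ.2.2 + μ.2.1) t)) := by
  have hB : 0 < 1 + ε₀ := by linarith
  simp only [quadTerm, Finset.mul_sum]
  refine Finset.sum_congr rfl fun i₁ _ => Finset.sum_congr rfl fun i₂ _ =>
    Finset.sum_congr rfl fun μ _ => ?_
  have hexp : (1 + ε₀) ^ ((5 : ℝ) / 2 * (n : ℝ)) * (1 + ε₀) ^ ((5 : ℝ) * ((n : ℝ) - (μ.2.2 : ℝ)) / 2) =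
      (1 + ε₀) ^ ((5 : ℝ) / 2 * ((μ.2.2 : ℝ) - (μ.1 : ℝ) - (μ.2.1 : ℝ))) *
        ((1 + ε₀) ^ ((5 : ℝ) / 2 * ((n - μ.2.2 + μ.1 : ℤ) : ℝ)) *
          (1 + ε₀) ^ ((5 : ℝ) / 2 * ((n - μ.2.2 + μ.2.1 : ℤ) : ℝ))) := by
    rw [← Real.rpow_add hB, ← Real.rpow_add hB, ← Real.rpow_add hB]
    congr 1; push_cast; ring
  calc (1 + ε₀) ^ ((5 : ℝ) / 2 * (n : ℝ)) *
        (α i₁ i₂ i μ * (1 + ε₀) ^ ((5 : ℝ) * ((n : ℝ) - (μ.2.2 : ℝ)) / 2) *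
          (X i₁ (n - μ.2.2 + μ.1) t * X i₂ (n - μ.2.2 + μ.2.1) t))
      = α i₁ i₂ i μ * ((1 + ε₀) ^ ((5 : ℝ) / 2 * (n : ℝ)) *
          (1 + ε₀) ^ ((5 : ℝ) * ((n : ℝ) - (μ.2.2 : ℝ)) / 2)) *
          (X i₁ (n - μ.2.2 + μ.1) t * X i₂ (n - μ.2.2 + μ.2.1) t) := by ring
    _ = α i₁ i₂ i μ * ((1 + ε₀) ^ ((5 : ℝ) / 2 * ((μ.2.2 : ℝ) - (μ.1 : ℝ) - (μ.2.1 : ℝ))) *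
        ((1 + ε₀) ^ ((5 : ℝ) / 2 * ((n - μ.2.2 + μ.1 : ℤ) : ℝ)) *
          (1 + ε₀) ^ ((5 : ℝ) / 2 * ((n - μ.2.2 + μ.2.1 : ℤ) : ℝ)))) *
          (X i₁ (n - μ.2.2 + μ.1) t * X i₂ (n - μ.2.2 + μ.2.1) t) := by rw [hexp]
    _ = _ := by ring

/-- **The four KP weights on Tao's shift set.** For `μ ∈ S = {(0,0,0),(1,0,0),(0,1,0),(0,0,1)}` the weight
`λ^{μ₃−μ₁−μ₂}` of `kpWeight_quadTerm` is `1` (in-shell term), `λ⁻¹ = (1+ε₀)^{-5/2}` (the two back-reaction shifts) or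
`λ = (1+ε₀)^{5/2}` (the forward feed). [cite: Tao2016AveragedNS, §4 after (4.1)] -/
theorem kpWeight_shift_values {ε₀ : ℝ} (μ : ℤ × ℤ × ℤ) (hμ : μ ∈ shiftSet) :
    (1 + ε₀) ^ ((5 : ℝ) / 2 * ((μ.2.2 : ℝ) - (μ.1 : ℝ) - (μ.2.1 : ℝ))) =
      if μ = (0, 0, 1) then (1 + ε₀) ^ ((5 : ℝ) / 2)
      else if μ = (0, 0, 0) then 1 else (1 + ε₀) ^ (-(5 : ℝ) / 2) := by
  rcases (mem_shiftSet_iff μ).1 hμ with rfl | rfl | rfl | rfl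
  · simp
  · norm_num
  · norm_num
  · norm_num

/-- **The weighted amplitudes solve an autonomous shell-homogeneous lattice.** If `X_{i,k}` obeys Tao's viscous model
equation `X' = quadTerm ε₀ α X i k − ν (1+ε₀)^{2k} X` within `s` at `t`, then `W_{i,k} = λ^k X_{i,k}` obeys
`W' = λ^k · quadTerm ε₀ α X i k − ν (1+ε₀)^{2k} W` there, whose nonlinear part is the shell-free form of `kpWeight_quadTerm`.
[cite: Tao2016AveragedNS, §4 (4.13)] [cite: DombreGilson1998, §3] -/
theorem kpWeight_hasDerivWithinAt {ε₀ ν : ℝ} {m : ℕ} {α : Fin m → Fin m → Fin m → ℤ × ℤ × ℤ → ℝ}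
    {X : Fin m → ℤ → ℝ → ℝ} {s : Set ℝ} {i : Fin m} {k : ℤ} {t : ℝ}
    (hX : HasDerivWithinAt (X i k)
      (quadTerm ε₀ α X i k t - ν * (1 + ε₀) ^ ((2 : ℝ) * k) * X i k t) s t) :
    HasDerivWithinAt (fun τ => (1 + ε₀) ^ ((5 : ℝ) / 2 * (k : ℝ)) * X i k τ)
      ((1 + ε₀) ^ ((5 : ℝ) / 2 * (k : ℝ)) * quadTerm ε₀ α X i k t -
        ν * (1 + ε₀) ^ ((2 : ℝ) * k) * ((1 + ε₀) ^ ((5 : ℝ) / 2 * (k : ℝ)) * X i k t)) s t := by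
  have h := hX.const_mul ((1 + ε₀) ^ ((5 : ℝ) / 2 * (k : ℝ)))
  have heq : (1 + ε₀) ^ ((5 : ℝ) / 2 * (k : ℝ)) *
      (quadTerm ε₀ α X i k t - ν * (1 + ε₀) ^ ((2 : ℝ) * k) * X i k t) =
      (1 + ε₀) ^ ((5 : ℝ) / 2 * (k : ℝ)) * quadTerm ε₀ α X i k t -
        ν * (1 + ε₀) ^ ((2 : ℝ) * k) * ((1 + ε₀) ^ ((5 : ℝ) / 2 * (k : ℝ)) * X i k t) := by ring
  rw [heq] at h
  exact h

end Summit.NavierStokesRegularity.NavierStokesRegularity.Theorems
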